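import Summits.QuantumFields.YangMills.Theorems.BalabanUVNodesN15TwoSpacingGluingCurvedKnitGradientCap
import Summits.QuantumFields.YangMills.Theorems.BalabanUVNodesN15CovariantLandauPropagatorPair
import Summits.QuantumFields.YangMills.Theorems.BalabanUVNodesN15TwoSpacingGluingCurvedKnitCovariantAveragingDefectRows
import Summits.QuantumFields.YangMills.Theorems.BalabanUVNodesN15TwoSpacingGluingCurvedKnitSmallFieldGradient
import Summits.QuantumFields.YangMills.Theorems.BalabanUVNodesN15BackgroundV1MeanGaugeLetters
import HarnessLib
/-!
# N15 = NE2 — dag-n15-a g33, PROGRAMME (P-R)₄ «ALL FOUR ENTRIES OF (3.42) FOR THE (P-R) FAMILY», (R3): THE FLAT JET COMPONENTS `∇_j ∘ X_r` OF THE COARSE (P-R) GLUED PROPAGATOR —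
# Bałaban's WHOLE covariant summand `P = N_L ⊗ 1 − N_V^Q − N_V^R` live — ARE BLOCK-LOCAL, rate-capped, the Landau letter's coarse one-grid row DISPLAYED (n15-c∕194 `sfq_jet_cvGlued_spec`'s
# text at `P_r`, over (R1) `one_jet_cvGlued_spec_cap`)
# (dag-n15-a g33, (R3); node N15 = NE2; `--supports stmt-QuantumFields-27366 --as helper`, count-neutral; one theorem; imports (R1), (t2) F2, n15-c∕194's parents)

WHY.  The covariant-gradient entries 1–2 of (3.42) for a glued family need the one-grid letter «`∇_j ∘ G` is block-local» (dag-n15-a FILE 144 ∕ n15-c∕195's input n15-c∕194).  For the (P-R)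
family — the propagator `X_r` of n15-c∕207a `sfqrEntry0`, (t2) F2 `sfqr_cvGlued_pair_spec` — the summand carries the Landau perturbation `N_V^R` (n15-c∕201), whose rows come with their own
rate ([Balaban1985BackgroundPropagators] (3.49)); FILE 142 asks its `N_V` rows at its own existential rate, hence (R1)'s cap.  THIS FILE = n15-c∕194's statement and proof text at
`P := N_L ⊗ 1 − N_V^Q − N_V^R`, `N_V := N_V^Q + N_V^R`, over (R1): the `N_V^Q` rows discharged as in 194 (187b), the `N_V^R` row DISPLAYED as ONE coarse global row at the cap rate `δ_e`
(207b's `hG` coarse row at the index, `ρ_R = c_R·r_A`) and fed into FILE 142's near ∕ far cut-off rows by sandwiching (cut-offs bounded by one) — (t2) F2's device, letter for letter.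

THE RESULT ★★ `sfqr_jet_cvGlued_spec (hδe)`: `∃ δ ≤ δ_e, w₀, R₀, θ₀, R₁, B > 0`, for every index (`k ≥ 1`, `L^m ≥ w₀`), refinement `r`, jet index `j = ±μ`, trace-form coordinates, skew `A′`
in FILE 130's C² window at scale `r_A ≤ 1`, Landau letter `ρ_R ≥ 0` with `S(1+|J⊕J|) + R₁(K+K₁) + ρ_R ≤ R₀`, `R₁(K+K₁) + ρ_R ≤ θ₀`, transporter sizes `K, K₁ ≤ 1`, and the coarse Landau row
`N_V^R(e^{ηĀ′}) ≤ ρ_R e^{−δ_e d}`: `∇_j ∘ X_r(A′) ≤ B e^{−δ d}` blockwise (coarse grid).  Sequel: (R4) the two-grid η-defect of the jets over (R2), (R6) the covariant-gradient entries.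

HONEST FRAMING ∕ LIMITS.  MODEL operator ∕ class ∕ carriers of dag-n15-c (doubled-torus cover, global small-field gauge `U = e^{ηĀ′}`, `Q(U)` = main term (125) of [B7] (124), flat jets
`fgrad`∕`bgrad`, crude constants); the Landau row is a HYPOTHESIS (n15-c∕217–220 reduce it to primitive flat rows); NOT [Balaban1985BackgroundPropagators] Thm 3.1 ∕ (3.42) as printed and
no estimate of Bałaban's; NE2⁺ NOT PRINTED here; N15 of record untouched (DISCHARGED AS CONSUMED, p687738) — no re-pin, no count moved; K3⁸ OPEN; one finite 𝕋⁴ at fixed ε per index — NOT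
infinite volume ∕ OS ∕ mass gap ∕ Clay.  `set_option maxHeartbeats 1600000 in` = 194's budget.  Restate-immune (no Theses import).
-/

noncomputable section

open scoped BigOperators Matrix

namespace Summit.QuantumFields.YangMills.BalabanUVNodes.N15.Gluing

open Literature.MathematicalPhysics.QuantumFieldTheory.Balaban1983to89
open Literature.MathematicalPhysics.QuantumFieldTheory.Balaban1983to89.B11SectG (BlockNorm HasMaj)
open Literature.MathematicalPhysics.QuantumFieldTheory.Balaban1983to89.B6Prop26Gluing (mulOp mulOp_apply)
open Literature.MathematicalPhysics.QuantumFieldTheory.Balaban1983to89.B6UnitTorusCarrier (unitTorusGeo unitTorusGeo_dist unitTorusGeo_dist_nonneg)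
open Literature.MathematicalPhysics.QuantumFieldTheory.King1986.Torus (blockOf)
open Literature.Barriers.QuantumFields (traceForm)
open Literature.MathematicalPhysics.QuantumFieldTheory.Balaban1983to89.Beta.AveragingCorrectionJets (adCLM)
open Summit.QuantumFields.YangMills.BalabanUVNodes.N15.BackgroundLayer (covLapM tCoefA tCoefC gavgM gaugeLetters_of_mean fgrad bgrad)
open Summit.QuantumFields.YangMills.BalabanUVNodes.N15.VectorPiece (bshiftEquiv kingPrV kingPrV_bshiftEquiv_pow fibre_conn_kingPrV bshiftEquiv_comm)
open Summit.QuantumFields.YangMills.BalabanUVNodes.N15.MatrixSpecies (mmulOp coordMat basisConst basisConst_nonneg liftBlk liftMap liftEquiv)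
open Summit.QuantumFields.YangMills.BalabanUVNodes.N15.TwoGrid (chiCube abs_chiCube_le_one)
open Summit.QuantumFields.YangMills.BalabanUVNodes.N15.CurvedSpecies (gaugePair expTrField curvCoefC_one curvCoefA_one twoSidedLetters_curvCoef_one_of_meanGauge
  coordMat_adCLM_transpose_eq_neg_of_conjTranspose)
open Summit.QuantumFields.YangMills.BalabanUVNodes.N15.CovAvg (hasMaj_nvQ)
open Literature.NumberTheory.Sieve.SquarefreeSums (exp_sub_one_le_two_mul)

variable {d : ℕ}

section Jet

open scoped Matrix.Norms.L2Operator

variable {L : ℕ} [NeZero L]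

set_option maxHeartbeats 1600000 in
/-- ★★ **THE FLAT JET COMPONENTS OF THE COARSE (P-R) GLUED PROPAGATOR `X_r` ARE BLOCK-LOCAL, GIVEN THE COARSE LANDAU ROW** (statement in the module docstring; operator norms; n15-c∕194's
text at `P := N_L ⊗ 1 − N_V^Q − N_V^R` over (R1), the `N_V^R` row displayed at the cap rate and sandwiched as in (t2) F2).  MODEL operator ∕ class ∕ carriers; the Landau row is a HYPOTHESIS.
[cite: Balaban1985BackgroundPropagators, (3.25)–(3.26) p.395, (3.42) p.397 (gradient entries: shape), (3.49) p.399 (shape of the Landau row), (3.62)–(3.65) pp.402–403; Balaban1984PropagatorsII, (2.91)–(2.93) p.239] -/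
theorem sfqr_jet_cvGlued_spec (hL : Odd L ∧ 1 < L) (hL7 : 7 ≤ L) {a : ℝ} (ha : 0 < a) (ι : Type) [Fintype ι] [DecidableEq ι] {δe : ℝ} (hδe : 0 < δe) :
    ∃ δ w₀ R₀ θ₀ R₁ B : ℝ, 0 < δ ∧ δ ≤ δe ∧ 0 < R₀ ∧ 0 < θ₀ ∧ 0 < R₁ ∧ 0 < B ∧
      ∀ (mv kk r : ℕ) (j : Fin (d + 1) ⊕ Fin (d + 1)), 1 ≤ kk → w₀ ≤ ((L ^ mv : ℕ) : ℝ) →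
      ∀ {mm : Type} [Fintype mm] [DecidableEq mm] (e : Matrix mm mm ℂ ≃L[ℝ] (ι → ℝ)), (∀ A B : Matrix mm mm ℂ, traceForm A B = e A ⬝ᵥ e B) →
      ∀ (A' : Fin (d + 1) → CvX' d L mv kk r hL → Matrix mm mm ℂ), (∀ μ x', (A' μ x')ᴴ = -A' μ x') →
      ∀ (rA : ℝ), 0 ≤ rA → rA ≤ 1 → (∀ μ x', ‖A' μ x'‖ ≤ rA) →
        (∀ μ κ x', ‖A' μ (bshiftEquiv (cvM d L mv kk hL) (L ^ r * L ^ kk) κ x') - A' μ x'‖ ≤ rA * ((((L ^ r * L ^ kk : ℕ) : ℝ))⁻¹)) →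
        (∀ μ κ x', ‖(A' μ (bshiftEquiv (cvM d L mv kk hL) (L ^ r * L ^ kk) κ x') - A' μ x') -
            (A' μ (bshiftEquiv (cvM d L mv kk hL) (L ^ r * L ^ kk) κ ((bshiftEquiv (cvM d L mv kk hL) (L ^ r * L ^ kk) μ).symm x')) -
              A' μ ((bshiftEquiv (cvM d L mv kk hL) (L ^ r * L ^ kk) μ).symm x'))‖ ≤ rA * ((((L ^ r * L ^ kk : ℕ) : ℝ))⁻¹) * ((((L ^ r * L ^ kk : ℕ) : ℝ))⁻¹)) →
        2 * ((1 + Fintype.card (Fin (d + 1))) * ((3 + 2 * ((d : ℝ) + 1)) * rA)) ≤ 1 →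
      ∀ (ρR : ℝ), 0 ≤ ρR →
        (14 * Real.exp 1 * (1 + Fintype.card (Fin (d + 1))) * basisConst e * ((1 + Fintype.card (Fin (d + 1))) * ((3 + 2 * ((d : ℝ) + 1)) * rA))) * (1 + Fintype.card (Fin (d + 1) ⊕ Fin (d + 1))) + R₁ * (((1 + Fintype.card ι * (@basisConst ι _ (Matrix mm mm ℂ) Matrix.frobeniusNormedAddCommGroup Matrix.frobeniusNormedSpace e * (2 * Real.sqrt (Fintype.card mm)) * (Real.sqrt (Fintype.card mm) * (2 * (rA * ((((L ^ kk : ℕ) : ℝ))⁻¹)))))) ^ ((d + 2) * L ^ kk) - 1) + ((1 + Fintype.card ι * (@basisConst ι _ (Matrix mm mm ℂ) Matrix.frobeniusNormedAddCommGroup Matrix.frobeniusNormedSpace e * (2 * Real.sqrt (Fintype.card mm)) * (Real.sqrt (Fintype.card mm) * (2 * (rA * ((((L ^ r * L ^ kk : ℕ) : ℝ))⁻¹)))))) ^ ((d + 2) * (L ^ r * L ^ kk)) - 1)) + ρR ≤ R₀ →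
        R₁ * (((1 + Fintype.card ι * (@basisConst ι _ (Matrix mm mm ℂ) Matrix.frobeniusNormedAddCommGroup Matrix.frobeniusNormedSpace e * (2 * Real.sqrt (Fintype.card mm)) * (Real.sqrt (Fintype.card mm) * (2 * (rA * ((((L ^ kk : ℕ) : ℝ))⁻¹)))))) ^ ((d + 2) * L ^ kk) - 1) + ((1 + Fintype.card ι * (@basisConst ι _ (Matrix mm mm ℂ) Matrix.frobeniusNormedAddCommGroup Matrix.frobeniusNormedSpace e * (2 * Real.sqrt (Fintype.card mm)) * (Real.sqrt (Fintype.card mm) * (2 * (rA * ((((L ^ r * L ^ kk : ℕ) : ℝ))⁻¹)))))) ^ ((d + 2) * (L ^ r * L ^ kk)) - 1)) + ρR ≤ θ₀ → ((1 + Fintype.card ι * (@basisConst ι _ (Matrix mm mm ℂ) Matrix.frobeniusNormedAddCommGroup Matrix.frobeniusNormedSpace e * (2 * Real.sqrt (Fintype.card mm)) * (Real.sqrt (Fintype.card mm) * (2 * (rA * ((((L ^ kk : ℕ) : ℝ))⁻¹)))))) ^ ((d + 2) * L ^ kk) - 1) ≤ 1 → ((1 + Fintype.card ι * (@basisConst ι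 _ (Matrix mm mm ℂ) Matrix.frobeniusNormedAddCommGroup Matrix.frobeniusNormedSpace e * (2 * Real.sqrt (Fintype.card mm)) * (Real.sqrt (Fintype.card mm) * (2 * (rA * ((((L ^ r * L ^ kk : ℕ) : ℝ))⁻¹)))))) ^ ((d + 2) * (L ^ r * L ^ kk)) - 1) ≤ 1 →
        HasMaj (CvNorm d L mv kk hL ι) (CvNorm d L mv kk hL ι) (cvNVr d L mv kk hL a ι e (fun μ x => NormedSpace.exp (((((L ^ kk : ℕ) : ℝ))⁻¹) • gavgM (Matrix mm mm ℂ) (Fin (d + 1)) (kingPrV L kk r (cvM d L mv kk hL)) A' μ x))) (fun y y' => ρR * Real.exp (-(δe * (unitTorusGeo L kk (cvM d L mv kk hL)).dist y y'))) →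
        HasMaj (CvNorm d L mv kk hL ι) (CvNorm d L mv kk hL ι)
          (Sum.elim (fun μ => fgrad ((((L ^ kk : ℕ) : ℝ))⁻¹)⁻¹ (liftEquiv (bshiftEquiv (cvM d L mv kk hL) (L ^ kk) μ) ι)) (fun μ => bgrad ((((L ^ kk : ℕ) : ℝ))⁻¹)⁻¹ (liftEquiv (bshiftEquiv (cvM d L mv kk hL) (L ^ kk) μ) ι)) j ∘ₗ
            cvGlued d L mv kk hL a ((((L ^ kk : ℕ) : ℝ))⁻¹) ι e (fun _ _ => (1 : Matrix mm mm ℂ)) (fun μ x => NormedSpace.exp (((((L ^ kk : ℕ) : ℝ))⁻¹) • gavgM (Matrix mm mm ℂ) (Fin (d + 1)) (kingPrV L kk r (cvM d L mv kk hL)) A' μ x)) (cvNL d L mv kk hL a ι - (cvNVq d L mv kk hL a ι e (fun μ x => NormedSpace.exp (((((L ^ kk : ℕ) : ℝ))⁻¹) • gavgM (Matrix mm mm ℂ) (Fin (d + 1)) (kingPrV L kk r (cvM d L mv kk hL)) A' μ x))) - (cvNVr d L mv kk hL a ι e (fun μ x => NormedSpace.exp (((((L ^ kk : ℕ) : ℝ))⁻¹)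 • gavgM (Matrix mm mm ℂ) (Fin (d + 1)) (kingPrV L kk r (cvM d L mv kk hL)) A' μ x)))) (fun _ => (cvNVq d L mv kk hL a ι e (fun μ x => NormedSpace.exp (((((L ^ kk : ℕ) : ℝ))⁻¹) • gavgM (Matrix mm mm ℂ) (Fin (d + 1)) (kingPrV L kk r (cvM d L mv kk hL)) A' μ x))) + (cvNVr d L mv kk hL a ι e (fun μ x => NormedSpace.exp (((((L ^ kk : ℕ) : ℝ))⁻¹) • gavgM (Matrix mm mm ℂ) (Fin (d + 1)) (kingPrV L kk r (cvM d L mv kk hL)) A' μ x)))))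
          (fun y y' => B * Real.exp (-(δ * (unitTorusGeo L kk (cvM d L mv kk hL)).dist y y'))) := by
  have hLpos : 0 < L := Nat.pos_of_ne_zero (NeZero.ne L)
  obtain ⟨δ₁, w₁, R₁', θ₁, B₁, hδ₁, hδ₁e, hR₁', hθ₁, hB₁, H₁⟩ := one_jet_cvGlued_spec_cap (d := d) hL hL7 ha ι hδe
  have hc10 : 0 ≤ B4Sect5Proof.latticeConst (d + 1) δ₁ := B4Sect5Proof.latticeConst_nonneg (d + 1) hδ₁.le
  refine ⟨δ₁ / 16, w₁, R₁', θ₁, 3 * |a| * (B4Sect5Proof.latticeConst (d + 1) δ₁ * Real.exp (3 * δ₁)) + 1, B₁, by positivity, by linarith only [hδ₁e, hδ₁], hR₁', hθ₁, by positivity, hB₁, fun mv kk r j hk hw₀ => ?_⟩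
  set Rq : ℝ := 3 * |a| * (B4Sect5Proof.latticeConst (d + 1) δ₁ * Real.exp (3 * δ₁)) + 1 with hRqdef
  intro mm _ _ e he A' hA' rA hrA hrA1 h1 h2 h3 hr2 ρR hρR hRle hθle hKc hKf hGr
  have hw₁ : w₁ ≤ ((L ^ mv : ℕ) : ℝ) := hw₀
  -- the two spacings
  have hkpos : (0 : ℝ) < ((L ^ kk : ℕ) : ℝ) := Nat.cast_pos.mpr (pow_pos hLpos kk)
  have hrkpos : (0 : ℝ) < ((L ^ r * L ^ kk : ℕ) : ℝ) := Nat.cast_pos.mpr (Nat.mul_pos (pow_pos hLpos r) (pow_pos hLpos kk))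
  have hη : (0 : ℝ) < ((((L ^ kk : ℕ) : ℝ))⁻¹) := inv_pos.mpr hkpos
  have hη' : (0 : ℝ) < ((((L ^ r * L ^ kk : ℕ) : ℝ))⁻¹) := inv_pos.mpr hrkpos
  have hN : ((((L ^ kk : ℕ) : ℝ))⁻¹) = ((L ^ r : ℕ) : ℝ) * ((((L ^ r * L ^ kk : ℕ) : ℝ))⁻¹) := by
    have hr0 : ((L ^ r : ℕ) : ℝ) ≠ 0 := Nat.cast_ne_zero.mpr (pow_ne_zero _ (NeZero.ne L))
    rw [Nat.cast_mul]; field_simp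
  have hη1 : ((((L ^ kk : ℕ) : ℝ))⁻¹) ≤ 1 := inv_le_one_of_one_le₀ (by exact_mod_cast Nat.one_le_pow kk L hLpos)
  have hη'1 : ((((L ^ r * L ^ kk : ℕ) : ℝ))⁻¹) ≤ 1 := inv_le_one_of_one_le₀ (by exact_mod_cast Nat.mul_pos (Nat.one_le_pow r L hLpos) (Nat.one_le_pow kk L hLpos))
  have hC₀ : (0 : ℝ) ≤ 2 * ((d : ℝ) + 1) := by positivity
  have hCθ : (((2 * ((d + 1) * (L ^ r - 1)) : ℕ) : ℝ)) * ((((L ^ r * L ^ kk : ℕ) : ℝ))⁻¹) ≤ 2 * ((d : ℝ) + 1) * ((((L ^ kk : ℕ) : ℝ))⁻¹) := by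
    have hsub : (((L ^ r - 1 : ℕ)) : ℝ) ≤ ((L ^ r : ℕ) : ℝ) := by exact_mod_cast Nat.sub_le _ _
    have hcast : (((2 * ((d + 1) * (L ^ r - 1)) : ℕ) : ℝ)) = 2 * ((d : ℝ) + 1) * (((L ^ r - 1 : ℕ)) : ℝ) := by push_cast; ring
    rw [hcast, hN]
    calc 2 * ((d : ℝ) + 1) * (((L ^ r - 1 : ℕ)) : ℝ) * ((((L ^ r * L ^ kk : ℕ) : ℝ))⁻¹) ≤ 2 * ((d : ℝ) + 1) * ((L ^ r : ℕ) : ℝ) * ((((L ^ r * L ^ kk : ℕ) : ℝ))⁻¹) :=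
          mul_le_mul_of_nonneg_right (mul_le_mul_of_nonneg_left hsub hC₀) hη'.le
      _ = 2 * ((d : ℝ) + 1) * (((L ^ r : ℕ) : ℝ) * ((((L ^ r * L ^ kk : ℕ) : ℝ))⁻¹)) := by ring
  -- King's pairing geometry and skewness in coordinates; the sup of the block mean
  have hcomm := fun μ κ (x : CvX' d L mv kk r hL) => bshiftEquiv_comm (cvM d L mv kk hL) (L ^ r * L ^ kk) μ κ x
  have hconn := fun (f : CvX' d L mv kk r hL → Matrix mm mm ℂ) (β : ℝ)
      (hf : ∀ κ x, ‖f (bshiftEquiv (cvM d L mv kk hL) (L ^ r * L ^ kk) κ x) - f x‖ ≤ β) => fibre_conn_kingPrV L kk r (cvM d L mv kk hL) f β hf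
  have hblk := fun μ (x' : CvX' d L mv kk r hL) => kingPrV_bshiftEquiv_pow L kk r (cvM d L mv kk hL) μ x'
  have hAm : ∀ μ x, (gavgM (Matrix mm mm ℂ) (Fin (d + 1)) (kingPrV L kk r (cvM d L mv kk hL)) A' μ x)ᴴ = -gavgM (Matrix mm mm ℂ) (Fin (d + 1)) (kingPrV L kk r (cvM d L mv kk hL)) A' μ x := gavgM_conjTranspose_of_skew (kingPrV L kk r (cvM d L mv kk hL)) hA'
  have hA'c := fun μ x' => coordMat_adCLM_transpose_eq_neg_of_conjTranspose e he (hA' μ x')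
  have hAmc := fun μ x => coordMat_adCLM_transpose_eq_neg_of_conjTranspose e he (hAm μ x)
  obtain ⟨g1, -, -, -, -, -⟩ := gaugeLetters_of_mean (π := (kingPrV L kk r (cvM d L mv kk hL))) (s := bshiftEquiv (cvM d L mv kk hL) (L ^ kk))
    (s' := bshiftEquiv (cvM d L mv kk hL) (L ^ r * L ^ kk)) (N := L ^ r) (Cπ := (((2 * ((d + 1) * (L ^ r - 1)) : ℕ) : ℝ))) hcomm hconn hblk hη' hN hη hrA h1 h2 h3
  obtain ⟨hc, hcA, -, -, -, -, -, -, -, -, -, -, -, -, -⟩ :=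
    twoSidedLetters_curvCoef_one_of_meanGauge e (π := (kingPrV L kk r (cvM d L mv kk hL))) (s := bshiftEquiv (cvM d L mv kk hL) (L ^ kk))
      (s' := bshiftEquiv (cvM d L mv kk hL) (L ^ r * L ^ kk)) (N := L ^ r) (θ := ((((L ^ kk : ℕ) : ℝ))⁻¹)) (Cπ := (((2 * ((d + 1) * (L ^ r - 1)) : ℕ) : ℝ))) (C₀ := 2 * ((d : ℝ) + 1))
      hcomm hconn hblk hη' hN hη hη1 le_rfl hC₀ hCθ hrA hr2 hA'c hAmc h1 h2 h3
  have hce : ∀ {X : Type} (η : ℝ) {A : Fin (d + 1) → X → Matrix mm mm ℂ}, (∀ μ x, (A μ x)ᴴ = -A μ x) →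
      (fun μ x => coordMat e (ContinuousLinearMap.mulLeftRight ℝ (Matrix mm mm ℂ) ((1 : Matrix mm mm ℂ) * NormedSpace.exp (η • A μ x) * (1 : Matrix mm mm ℂ)ᴴ)
        ((1 : Matrix mm mm ℂ) * NormedSpace.exp (η • A μ x) * (1 : Matrix mm mm ℂ)ᴴ)ᴴ)) = expTrField e η (fun μ x => adCLM ℝ (A μ x)) :=
    fun η _ hA => conj_one_exp_eq_expTrField e η hA
  rw [curvCoefC_one, curvCoefA_one, ← hce ((((L ^ kk : ℕ) : ℝ))⁻¹) hAm] at hc hcA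
  have hκ0 : 0 ≤ basisConst e := basisConst_nonneg e
  have hκF := @basisConst_nonneg ι _ (Matrix mm mm ℂ) Matrix.frobeniusNormedAddCommGroup Matrix.frobeniusNormedSpace e
  have hS0 : 0 ≤ (14 * Real.exp 1 * (1 + Fintype.card (Fin (d + 1))) * basisConst e * ((1 + Fintype.card (Fin (d + 1))) * ((3 + 2 * ((d : ℝ) + 1)) * rA))) := by positivity
  -- the cuts
  have hχ1 : ∀ (k : Fin (d + 1) → ZMod (2 * L)) (x : CvX d L mv kk hL), |cvChi d L mv kk hL k x| ≤ 1 := fun k x => abs_chiCube_le_one _ x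
  have hψ1 : ∀ (k : Fin (d + 1) → ZMod (2 * L)) (x : CvX d L mv kk hL), |cvPsi d L mv kk hL k x| ≤ 1 := fun k x => abs_chiCube_le_one _ x
  have h1ψ : ∀ (k : Fin (d + 1) → ZMod (2 * L)) (x : CvX d L mv kk hL), |(1 - cvPsi d L mv kk hL k) x| ≤ 1 := fun k x => by
    rw [Pi.sub_apply, Pi.one_apply]; unfold cvPsi chiCube; split_ifs <;> simp
  have hid : ∀ k : Fin (d + 1) → ZMod (2 * L), (LinearMap.id - mulOp (fun p : CvX d L mv kk hL × ι => cvPsi d L mv kk hL k p.1)) =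
      mulOp (fun p : CvX d L mv kk hL × ι => (1 - cvPsi d L mv kk hL k) p.1) := fun k =>
    LinearMap.ext fun f => funext fun p => by simp [mulOp_apply, sub_mul]
  -- (P-Q) the transporter letters of `e^{ηĀ′}`, `e^{η′A′}`
  have hexpc : Real.exp (((((L ^ kk : ℕ) : ℝ))⁻¹) * rA) - 1 ≤ 2 * (rA * ((((L ^ kk : ℕ) : ℝ))⁻¹)) := by
    have h := exp_sub_one_le_two_mul (x := ((((L ^ kk : ℕ) : ℝ))⁻¹) * rA) (by positivity) (mul_le_one₀ hη1 hrA hrA1); linarith [mul_comm ((((L ^ kk : ℕ) : ℝ))⁻¹) rA]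
  have hTr : ∀ μ p i, ∑ j, |(cvT e (fun μ x => NormedSpace.exp (((((L ^ kk : ℕ) : ℝ))⁻¹) • gavgM (Matrix mm mm ℂ) (Fin (d + 1)) (kingPrV L kk r (cvM d L mv kk hL)) A' μ x)) μ p - 1) i j| ≤ Fintype.card ι * (@basisConst ι _ (Matrix mm mm ℂ) Matrix.frobeniusNormedAddCommGroup Matrix.frobeniusNormedSpace e * (2 * Real.sqrt (Fintype.card mm)) * (Real.sqrt (Fintype.card mm) * (2 * (rA * ((((L ^ kk : ℕ) : ℝ))⁻¹))))) := fun μ p i =>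
    (sf_rows_cvT_exp_sub_one_le e hη.le hAm g1 μ p i).trans (by gcongr)
  have hTc : ∀ μ p j, ∑ i, |(cvT e (fun μ x => NormedSpace.exp (((((L ^ kk : ℕ) : ℝ))⁻¹) • gavgM (Matrix mm mm ℂ) (Fin (d + 1)) (kingPrV L kk r (cvM d L mv kk hL)) A' μ x)) μ p - 1) i j| ≤ Fintype.card ι * (@basisConst ι _ (Matrix mm mm ℂ) Matrix.frobeniusNormedAddCommGroup Matrix.frobeniusNormedSpace e * (2 * Real.sqrt (Fintype.card mm)) * (Real.sqrt (Fintype.card mm) * (2 * (rA * ((((L ^ kk : ℕ) : ℝ))⁻¹))))) := fun μ p j =>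
    (sf_cols_cvT_exp_sub_one_le e hη.le hAm g1 μ p j).trans (by gcongr)
  have hρc0 : 0 ≤ Fintype.card ι * (@basisConst ι _ (Matrix mm mm ℂ) Matrix.frobeniusNormedAddCommGroup Matrix.frobeniusNormedSpace e * (2 * Real.sqrt (Fintype.card mm)) * (Real.sqrt (Fintype.card mm) * (2 * (rA * ((((L ^ kk : ℕ) : ℝ))⁻¹))))) := by positivity
  -- (P-Q) the constants against `R₁(K + K₁)`
  have hce1 : 0 ≤ (B4Sect5Proof.latticeConst (d + 1) δ₁ * Real.exp (3 * δ₁)) := mul_nonneg hc10 (Real.exp_nonneg _)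
  have hRq0 : 0 ≤ Rq := by rw [hRqdef]; positivity
  have hKC0 : 0 ≤ ((1 + Fintype.card ι * (@basisConst ι _ (Matrix mm mm ℂ) Matrix.frobeniusNormedAddCommGroup Matrix.frobeniusNormedSpace e * (2 * Real.sqrt (Fintype.card mm)) * (Real.sqrt (Fintype.card mm) * (2 * (rA * ((((L ^ kk : ℕ) : ℝ))⁻¹)))))) ^ ((d + 2) * L ^ kk) - 1) := by have := one_le_pow₀ (M₀ := ℝ) (a := 1 + Fintype.card ι * (@basisConst ι _ (Matrix mm mm ℂ) Matrix.frobeniusNormedAddCommGroup Matrix.frobeniusNormedSpace e * (2 * Real.sqrt (Fintype.card mm)) * (Real.sqrt (Fintype.card mm) * (2 * (rA * ((((L ^ kk : ℕ) : ℝ))⁻¹)))))) (by linarith) (n := (d + 2) * L ^ kk); linarith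
  have hKF0 : 0 ≤ ((1 + Fintype.card ι * (@basisConst ι _ (Matrix mm mm ℂ) Matrix.frobeniusNormedAddCommGroup Matrix.frobeniusNormedSpace e * (2 * Real.sqrt (Fintype.card mm)) * (Real.sqrt (Fintype.card mm) * (2 * (rA * ((((L ^ r * L ^ kk : ℕ) : ℝ))⁻¹)))))) ^ ((d + 2) * (L ^ r * L ^ kk)) - 1) := by have := one_le_pow₀ (M₀ := ℝ) (a := 1 + Fintype.card ι * (@basisConst ι _ (Matrix mm mm ℂ) Matrix.frobeniusNormedAddCommGroup Matrix.frobeniusNormedSpace e * (2 * Real.sqrt (Fintype.card mm)) * (Real.sqrt (Fintype.card mm) * (2 * (rA * ((((L ^ r * L ^ kk : ℕ) : ℝ))⁻¹)))))) (le_add_of_nonneg_right (by positivity)) (n := (d + 2) * (L ^ r * L ^ kk)); linarith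
  have hconstC : |a| * (((1 + Fintype.card ι * (@basisConst ι _ (Matrix mm mm ℂ) Matrix.frobeniusNormedAddCommGroup Matrix.frobeniusNormedSpace e * (2 * Real.sqrt (Fintype.card mm)) * (Real.sqrt (Fintype.card mm) * (2 * (rA * ((((L ^ kk : ℕ) : ℝ))⁻¹)))))) ^ ((d + 2) * L ^ kk) - 1) * (2 + ((1 + Fintype.card ι * (@basisConst ι _ (Matrix mm mm ℂ) Matrix.frobeniusNormedAddCommGroup Matrix.frobeniusNormedSpace e * (2 * Real.sqrt (Fintype.card mm)) * (Real.sqrt (Fintype.card mm) * (2 * (rA * ((((L ^ kk : ℕ) : ℝ))⁻¹)))))) ^ ((d + 2) * L ^ kk) - 1)) * (B4Sect5Proof.latticeConst (d + 1) δ₁ * Real.exp (3 * δ₁))) ≤ Rq * (((1 + Fintype.card ι * (@basisConst ι _ (Matrix mm mm ℂ) Matrix.frobeniusNormedAddCommGroup Matrix.frobeniusNormedSpace e * (2 * Real.sqrt (Fintype.card mm)) * (Real.sqrt (Fintype.card mm) * (2 * (rA * ((((L ^ kk : ℕ) : ℝ))⁻¹)))))) ^ ((d + 2) * L ^ kk)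 - 1) + ((1 + Fintype.card ι * (@basisConst ι _ (Matrix mm mm ℂ) Matrix.frobeniusNormedAddCommGroup Matrix.frobeniusNormedSpace e * (2 * Real.sqrt (Fintype.card mm)) * (Real.sqrt (Fintype.card mm) * (2 * (rA * ((((L ^ r * L ^ kk : ℕ) : ℝ))⁻¹)))))) ^ ((d + 2) * (L ^ r * L ^ kk)) - 1)) := by
    have h3 : ((1 + Fintype.card ι * (@basisConst ι _ (Matrix mm mm ℂ) Matrix.frobeniusNormedAddCommGroup Matrix.frobeniusNormedSpace e * (2 * Real.sqrt (Fintype.card mm)) * (Real.sqrt (Fintype.card mm) * (2 * (rA * ((((L ^ kk : ℕ) : ℝ))⁻¹)))))) ^ ((d + 2) * L ^ kk) - 1) * (2 + ((1 + Fintype.card ι * (@basisConst ι _ (Matrix mm mm ℂ) Matrix.frobeniusNormedAddCommGroup Matrix.frobeniusNormedSpace e * (2 * Real.sqrt (Fintype.card mm)) * (Real.sqrt (Fintype.card mm) * (2 * (rA * ((((L ^ kk : ℕ) : ℝ))⁻¹)))))) ^ ((d + 2) * L ^ kk) - 1)) ≤ 3 * ((1 + Fintype.card ι * (@basisConst ι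 _ (Matrix mm mm ℂ) Matrix.frobeniusNormedAddCommGroup Matrix.frobeniusNormedSpace e * (2 * Real.sqrt (Fintype.card mm)) * (Real.sqrt (Fintype.card mm) * (2 * (rA * ((((L ^ kk : ℕ) : ℝ))⁻¹)))))) ^ ((d + 2) * L ^ kk) - 1) := by nlinarith
    calc |a| * (((1 + Fintype.card ι * (@basisConst ι _ (Matrix mm mm ℂ) Matrix.frobeniusNormedAddCommGroup Matrix.frobeniusNormedSpace e * (2 * Real.sqrt (Fintype.card mm)) * (Real.sqrt (Fintype.card mm) * (2 * (rA * ((((L ^ kk : ℕ) : ℝ))⁻¹)))))) ^ ((d + 2) * L ^ kk) - 1) * (2 + ((1 + Fintype.card ι * (@basisConst ι _ (Matrix mm mm ℂ) Matrix.frobeniusNormedAddCommGroup Matrix.frobeniusNormedSpace e * (2 * Real.sqrt (Fintype.card mm)) * (Real.sqrt (Fintype.card mm) * (2 * (rA * ((((L ^ kk : ℕ) : ℝ))⁻¹)))))) ^ ((d + 2) * L ^ kk) - 1)) * (B4Sect5Proof.latticeConst (d + 1) δ₁ * Real.exp (3 * δ₁))) ≤ |a| * (3 * ((1 + Fintype.card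 ι * (@basisConst ι _ (Matrix mm mm ℂ) Matrix.frobeniusNormedAddCommGroup Matrix.frobeniusNormedSpace e * (2 * Real.sqrt (Fintype.card mm)) * (Real.sqrt (Fintype.card mm) * (2 * (rA * ((((L ^ kk : ℕ) : ℝ))⁻¹)))))) ^ ((d + 2) * L ^ kk) - 1) * (B4Sect5Proof.latticeConst (d + 1) δ₁ * Real.exp (3 * δ₁))) := by gcongr
      _ = 3 * |a| * (B4Sect5Proof.latticeConst (d + 1) δ₁ * Real.exp (3 * δ₁)) * ((1 + Fintype.card ι * (@basisConst ι _ (Matrix mm mm ℂ) Matrix.frobeniusNormedAddCommGroup Matrix.frobeniusNormedSpace e * (2 * Real.sqrt (Fintype.card mm)) * (Real.sqrt (Fintype.card mm) * (2 * (rA * ((((L ^ kk : ℕ) : ℝ))⁻¹)))))) ^ ((d + 2) * L ^ kk) - 1) := by ring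
      _ ≤ Rq * ((1 + Fintype.card ι * (@basisConst ι _ (Matrix mm mm ℂ) Matrix.frobeniusNormedAddCommGroup Matrix.frobeniusNormedSpace e * (2 * Real.sqrt (Fintype.card mm)) * (Real.sqrt (Fintype.card mm) * (2 * (rA * ((((L ^ kk : ℕ) : ℝ))⁻¹)))))) ^ ((d + 2) * L ^ kk) - 1) := mul_le_mul_of_nonneg_right (by rw [hRqdef]; linarith) hKC0
      _ ≤ Rq * (((1 + Fintype.card ι * (@basisConst ι _ (Matrix mm mm ℂ) Matrix.frobeniusNormedAddCommGroup Matrix.frobeniusNormedSpace e * (2 * Real.sqrt (Fintype.card mm)) * (Real.sqrt (Fintype.card mm) * (2 * (rA * ((((L ^ kk : ℕ) : ℝ))⁻¹)))))) ^ ((d + 2) * L ^ kk) - 1) + ((1 + Fintype.card ι * (@basisConst ι _ (Matrix mm mm ℂ) Matrix.frobeniusNormedAddCommGroup Matrix.frobeniusNormedSpace e * (2 * Real.sqrt (Fintype.card mm)) * (Real.sqrt (Fintype.card mm) * (2 * (rA * ((((L ^ r * L ^ kk : ℕ) : ℝ))⁻¹)))))) ^ ((d + 2) * (L ^ r * L ^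 kk)) - 1)) := mul_le_mul_of_nonneg_left (le_add_of_nonneg_right hKF0) hRq0
  have hRN0 : 0 ≤ Rq * (((1 + Fintype.card ι * (@basisConst ι _ (Matrix mm mm ℂ) Matrix.frobeniusNormedAddCommGroup Matrix.frobeniusNormedSpace e * (2 * Real.sqrt (Fintype.card mm)) * (Real.sqrt (Fintype.card mm) * (2 * (rA * ((((L ^ kk : ℕ) : ℝ))⁻¹)))))) ^ ((d + 2) * L ^ kk) - 1) + ((1 + Fintype.card ι * (@basisConst ι _ (Matrix mm mm ℂ) Matrix.frobeniusNormedAddCommGroup Matrix.frobeniusNormedSpace e * (2 * Real.sqrt (Fintype.card mm)) * (Real.sqrt (Fintype.card mm) * (2 * (rA * ((((L ^ r * L ^ kk : ℕ) : ℝ))⁻¹)))))) ^ ((d + 2) * (L ^ r * L ^ kk)) - 1)) := mul_nonneg hRq0 (add_nonneg hKC0 hKF0)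
  -- (P-Q) the one-grid rows of `N_V^Q` (coarse, FILE 120's norm) and of `N_V^Q′` (fine, FILE 122's norm)
  have rowC : ∀ (f χ : CvX d L mv kk hL → ℝ), (∀ x, |f x| ≤ 1) → (∀ x, |χ x| ≤ 1) →
      HasMaj (CvNorm d L mv kk hL ι) (CvNorm d L mv kk hL ι) (mulOp (fun p : CvX d L mv kk hL × ι => f p.1) ∘ₗ (cvNVq d L mv kk hL a ι e (fun μ x => NormedSpace.exp (((((L ^ kk : ℕ) : ℝ))⁻¹) • gavgM (Matrix mm mm ℂ) (Fin (d + 1)) (kingPrV L kk r (cvM d L mv kk hL)) A' μ x))) ∘ₗ mulOp (fun p : CvX d L mv kk hL × ι => χ p.1))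
        (fun y y' => Rq * (((1 + Fintype.card ι * (@basisConst ι _ (Matrix mm mm ℂ) Matrix.frobeniusNormedAddCommGroup Matrix.frobeniusNormedSpace e * (2 * Real.sqrt (Fintype.card mm)) * (Real.sqrt (Fintype.card mm) * (2 * (rA * ((((L ^ kk : ℕ) : ℝ))⁻¹)))))) ^ ((d + 2) * L ^ kk) - 1) + ((1 + Fintype.card ι * (@basisConst ι _ (Matrix mm mm ℂ) Matrix.frobeniusNormedAddCommGroup Matrix.frobeniusNormedSpace e * (2 * Real.sqrt (Fintype.card mm)) * (Real.sqrt (Fintype.card mm) * (2 * (rA * ((((L ^ r * L ^ kk : ℕ) : ℝ))⁻¹)))))) ^ ((d + 2) * (L ^ r * L ^ kk)) - 1)) * Real.exp (-(δ₁ * (unitTorusGeo L kk (cvM d L mv kk hL)).dist y y'))) := fun f χ hf hχ' =>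
    (cv_hasMaj_sandwich_cvNVq e mv kk hL a hρc0 hδ₁ hTr hTc f χ hf hχ').mono fun y y' => mul_le_mul_of_nonneg_right hconstC (Real.exp_nonneg _)
  -- (P-R) the displayed Landau row: rate `δ_e` weakened to the knit's rate `δ₁ ≤ δ_e`, then sandwiched between cut-offs bounded by one; the summand splits
  have hRNρ : 0 ≤ Rq * (((1 + Fintype.card ι * (@basisConst ι _ (Matrix mm mm ℂ) Matrix.frobeniusNormedAddCommGroup Matrix.frobeniusNormedSpace e * (2 * Real.sqrt (Fintype.card mm)) * (Real.sqrt (Fintype.card mm) * (2 * (rA * ((((L ^ kk : ℕ) : ℝ))⁻¹)))))) ^ ((d + 2) * L ^ kk) - 1) + ((1 + Fintype.card ι * (@basisConst ι _ (Matrix mm mm ℂ) Matrix.frobeniusNormedAddCommGroup Matrix.frobeniusNormedSpace e * (2 * Real.sqrt (Fintype.card mm)) * (Real.sqrt (Fintype.card mm) * (2 * (rA * ((((L ^ r * L ^ kk : ℕ) : ℝ))⁻¹)))))) ^ ((d + 2) * (L ^ r * L ^ kk)) - 1)) + ρR := add_nonneg hRN0 hρR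
  have hGr1 : HasMaj (CvNorm d L mv kk hL ι) (CvNorm d L mv kk hL ι) (cvNVr d L mv kk hL a ι e (fun μ x => NormedSpace.exp (((((L ^ kk : ℕ) : ℝ))⁻¹) • gavgM (Matrix mm mm ℂ) (Fin (d + 1)) (kingPrV L kk r (cvM d L mv kk hL)) A' μ x))) (fun y y' => ρR * Real.exp (-(δ₁ * (unitTorusGeo L kk (cvM d L mv kk hL)).dist y y'))) :=
    hGr.mono fun y y' => mul_le_mul_of_nonneg_left (Real.exp_le_exp.mpr (neg_le_neg (mul_le_mul_of_nonneg_right hδ₁e (unitTorusGeo_dist_nonneg L kk (cvM d L mv kk hL) y y')))) hρR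
  have rowRC : ∀ (f χ : CvX d L mv kk hL → ℝ), (∀ x, |f x| ≤ 1) → (∀ x, |χ x| ≤ 1) →
      HasMaj (CvNorm d L mv kk hL ι) (CvNorm d L mv kk hL ι) (mulOp (fun p : CvX d L mv kk hL × ι => f p.1) ∘ₗ (cvNVr d L mv kk hL a ι e (fun μ x => NormedSpace.exp (((((L ^ kk : ℕ) : ℝ))⁻¹) • gavgM (Matrix mm mm ℂ) (Fin (d + 1)) (kingPrV L kk r (cvM d L mv kk hL)) A' μ x))) ∘ₗ mulOp (fun p : CvX d L mv kk hL × ι => χ p.1))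
        (fun y y' => ρR * Real.exp (-(δ₁ * (unitTorusGeo L kk (cvM d L mv kk hL)).dist y y'))) := fun f χ hf hχ' =>
    hasMaj_sandwich_of_abs_le_one (g := unitTorusGeo L kk (cvM d L mv kk hL)) (liftBlk (cvBlk d L mv kk hL) ι) (N := (cvNVr d L mv kk hL a ι e (fun μ x => NormedSpace.exp (((((L ^ kk : ℕ) : ℝ))⁻¹) • gavgM (Matrix mm mm ℂ) (Fin (d + 1)) (kingPrV L kk r (cvM d L mv kk hL)) A' μ x))))
      (K := fun y y' => ρR * Real.exp (-(δ₁ * (unitTorusGeo L kk (cvM d L mv kk hL)).dist y y')))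
      (ψ := fun p : CvX d L mv kk hL × ι => f p.1) (χ := fun p : CvX d L mv kk hL × ι => χ p.1) (fun p => hf p.1) (fun p => hχ' p.1)
      (fun y y' => mul_nonneg hρR (Real.exp_nonneg _)) hGr1
  have hsplitC : ∀ (Z : (CvX d L mv kk hL × ι → ℝ) →ₗ[ℝ] (CvX d L mv kk hL × ι → ℝ)) (χ : CvX d L mv kk hL → ℝ),
      Z ∘ₗ ((cvNVq d L mv kk hL a ι e (fun μ x => NormedSpace.exp (((((L ^ kk : ℕ) : ℝ))⁻¹) • gavgM (Matrix mm mm ℂ) (Fin (d + 1)) (kingPrV L kk r (cvM d L mv kk hL)) A' μ x))) + (cvNVr d L mv kk hL a ι e (fun μ x => NormedSpace.exp (((((L ^ kk : ℕ) : ℝ))⁻¹) • gavgM (Matrix mm mm ℂ) (Fin (d + 1)) (kingPrV L kk r (cvM d L mv kk hL)) A' μ x)))) ∘ₗ mulOp (fun p : CvX d L mv kk hL × ι => χ p.1) =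
        Z ∘ₗ (cvNVq d L mv kk hL a ι e (fun μ x => NormedSpace.exp (((((L ^ kk : ℕ) : ℝ))⁻¹) • gavgM (Matrix mm mm ℂ) (Fin (d + 1)) (kingPrV L kk r (cvM d L mv kk hL)) A' μ x))) ∘ₗ mulOp (fun p : CvX d L mv kk hL × ι => χ p.1) + Z ∘ₗ (cvNVr d L mv kk hL a ι e (fun μ x => NormedSpace.exp (((((L ^ kk : ℕ) : ℝ))⁻¹) • gavgM (Matrix mm mm ℂ) (Fin (d + 1)) (kingPrV L kk r (cvM d L mv kk hL)) A' μ x))) ∘ₗ mulOp (fun p : CvX d L mv kk hL × ι => χ p.1) := fun Z χ => by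
    rw [LinearMap.add_comp, LinearMap.comp_add]
  -- the scale conditions at each level
  have hR₁le : (14 * Real.exp 1 * (1 + Fintype.card (Fin (d + 1))) * basisConst e * ((1 + Fintype.card (Fin (d + 1))) * ((3 + 2 * ((d : ℝ) + 1)) * rA))) * (1 + Fintype.card (Fin (d + 1) ⊕ Fin (d + 1))) + (Rq * (((1 + Fintype.card ι * (@basisConst ι _ (Matrix mm mm ℂ) Matrix.frobeniusNormedAddCommGroup Matrix.frobeniusNormedSpace e * (2 * Real.sqrt (Fintype.card mm)) * (Real.sqrt (Fintype.card mm) * (2 * (rA * ((((L ^ kk : ℕ) : ℝ))⁻¹)))))) ^ ((d + 2) * L ^ kk) - 1) + ((1 + Fintype.card ι * (@basisConst ι _ (Matrix mm mm ℂ) Matrix.frobeniusNormedAddCommGroup Matrix.frobeniusNormedSpace e * (2 * Real.sqrt (Fintype.card mm)) * (Real.sqrt (Fintype.card mm) * (2 * (rA * ((((L ^ r * L ^ kk : ℕ) : ℝ))⁻¹)))))) ^ ((d + 2) * (L ^ r * L ^ kk)) - 1)) + ρR) ≤ R₁' :=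
    (add_assoc _ _ _).symm.trans_le hRle
  have hθ₁le : Rq * (((1 + Fintype.card ι * (@basisConst ι _ (Matrix mm mm ℂ) Matrix.frobeniusNormedAddCommGroup Matrix.frobeniusNormedSpace e * (2 * Real.sqrt (Fintype.card mm)) * (Real.sqrt (Fintype.card mm) * (2 * (rA * ((((L ^ kk : ℕ) : ℝ))⁻¹)))))) ^ ((d + 2) * L ^ kk) - 1) + ((1 + Fintype.card ι * (@basisConst ι _ (Matrix mm mm ℂ) Matrix.frobeniusNormedAddCommGroup Matrix.frobeniusNormedSpace e * (2 * Real.sqrt (Fintype.card mm)) * (Real.sqrt (Fintype.card mm) * (2 * (rA * ((((L ^ r * L ^ kk : ℕ) : ℝ))⁻¹)))))) ^ ((d + 2) * (L ^ r * L ^ kk)) - 1)) + ρR ≤ θ₁ := hθle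
  refine (H₁ mv kk j hk hw₁ e he (fun μ x => NormedSpace.exp (((((L ^ kk : ℕ) : ℝ))⁻¹) • gavgM (Matrix mm mm ℂ) (Fin (d + 1)) (kingPrV L kk r (cvM d L mv kk hL)) A' μ x)) (cvNL d L mv kk hL a ι - (cvNVq d L mv kk hL a ι e (fun μ x => NormedSpace.exp (((((L ^ kk : ℕ) : ℝ))⁻¹) • gavgM (Matrix mm mm ℂ) (Fin (d + 1)) (kingPrV L kk r (cvM d L mv kk hL)) A' μ x))) - (cvNVr d L mv kk hL a ι e (fun μ x => NormedSpace.exp (((((L ^ kk : ℕ) : ℝ))⁻¹) • gavgM (Matrix mm mm ℂ) (Fin (d + 1)) (kingPrV L kk r (cvM d L mv kk hL)) A' μ x)))) (fun _ => (cvNVq d L mv kk hL a ι e (fun μ x => NormedSpace.exp (((((L ^ kk : ℕ) : ℝ))⁻¹) • gavgM (Matrix mm mm ℂ) (Fin (d + 1)) (kingPrV L kk r (cvM d L mv kk hL)) A' μ x))) + (cvNVr d L mv kk hL a ι e (fun μ x => NormedSpace.exp (((((L ^ kk : ℕ) : ℝ))⁻¹) • gavgM (Matrix mm mm ℂ) (Fin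 (d + 1)) (kingPrV L kk r (cvM d L mv kk hL)) A' μ x))))
    (14 * Real.exp 1 * (1 + Fintype.card (Fin (d + 1))) * basisConst e * ((1 + Fintype.card (Fin (d + 1))) * ((3 + 2 * ((d : ℝ) + 1)) * rA))) (Rq * (((1 + Fintype.card ι * (@basisConst ι _ (Matrix mm mm ℂ) Matrix.frobeniusNormedAddCommGroup Matrix.frobeniusNormedSpace e * (2 * Real.sqrt (Fintype.card mm)) * (Real.sqrt (Fintype.card mm) * (2 * (rA * ((((L ^ kk : ℕ) : ℝ))⁻¹)))))) ^ ((d + 2) * L ^ kk) - 1) + ((1 + Fintype.card ι * (@basisConst ι _ (Matrix mm mm ℂ) Matrix.frobeniusNormedAddCommGroup Matrix.frobeniusNormedSpace e * (2 * Real.sqrt (Fintype.card mm)) * (Real.sqrt (Fintype.card mm) * (2 * (rA * ((((L ^ r * L ^ kk : ℕ) : ℝ))⁻¹)))))) ^ ((d + 2) * (L ^ r * L ^ kk)) - 1)) + ρR) (Rq * (((1 + Fintype.card ι * (@basisConst ι _ (Matrix mm mm ℂ) Matrix.frobeniusNormedAddCommGroup Matrix.frobeniusNormedSpace e * (2 *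 Real.sqrt (Fintype.card mm)) * (Real.sqrt (Fintype.card mm) * (2 * (rA * ((((L ^ kk : ℕ) : ℝ))⁻¹)))))) ^ ((d + 2) * L ^ kk) - 1) + ((1 + Fintype.card ι * (@basisConst ι _ (Matrix mm mm ℂ) Matrix.frobeniusNormedAddCommGroup Matrix.frobeniusNormedSpace e * (2 * Real.sqrt (Fintype.card mm)) * (Real.sqrt (Fintype.card mm) * (2 * (rA * ((((L ^ r * L ^ kk : ℕ) : ℝ))⁻¹)))))) ^ ((d + 2) * (L ^ r * L ^ kk)) - 1)) + ρR) hS0 hRNρ hRNρ hR₁le hθ₁le (fun k => by rw [conj_one_eq_sub_zero, sub_zero, sub_sub])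
    (fun k x _ i => hc x i) (fun k j' x _ i => hcA j' x i)
    (fun k => by rw [hsplitC]; exact ((rowC (cvPsi d L mv kk hL k) (cvChi d L mv kk hL k) (hψ1 k) (hχ1 k)).add (rowRC (cvPsi d L mv kk hL k) (cvChi d L mv kk hL k) (hψ1 k) (hχ1 k))).mono fun y y' => (add_mul _ _ _).symm.le)
    (fun k => by rw [hid k, hsplitC]; exact ((rowC (1 - cvPsi d L mv kk hL k) (cvChi d L mv kk hL k) (h1ψ k) (hχ1 k)).add (rowRC (1 - cvPsi d L mv kk hL k) (cvChi d L mv kk hL k) (h1ψ k) (hχ1 k))).mono fun y y' => (add_mul _ _ _).symm.le)).mono fun y y' => ?_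
  have hd0 := unitTorusGeo_dist_nonneg L kk (cvM d L mv kk hL) y y'
  exact mul_le_mul_of_nonneg_left (Real.exp_le_exp.mpr (neg_le_neg (mul_le_mul_of_nonneg_right (by linarith) hd0))) hB₁.le

end Jet

end Summit.QuantumFields.YangMills.BalabanUVNodes.N15.Gluing

end
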